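import Literature.AlgebraicGeometry.AbelianSchemes.LevelSectionsSubgroup
import Literature.AlgebraicGeometry.AbelianSchemes.PolarizationLamImageFree
import Literature.AlgebraicGeometry.ModuliOfAbelianVarieties.SiegelHeckeKernelCard
import HarnessLib

/-!
# `#φ(K₀) = #K₀`: the constant subgroup of sections indexed through a level structure, and the Hecke kernel count `#K = ν^g`

Layer `Literature/AlgebraicGeometry/AbelianSchemes`, namespace `Literature.AlgebraicGeometry.AbelianSchemes.AbelianSchemeOver`.
THEOREMS ONLY (no definition, no named fact, no instance).  Cell hodgecm-mathlib (D-0151), Hecke-link socket (QT), brick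
(DET) of seat B-p15 (g10), third file: the passage from the index set `K₀ ≤ (ℤ/n)^{2g}` to the subgroup of sections
`K = φ(K₀) ≤ A(S)` of ★ `LevelStructure.exists_subgroup_mem_iff` (enumeration clause `σ ∈ K ↔ ∃ c ∈ K₀, φ(c) = σ`).

* `LevelStructure.section_injective` — `c ↦ φ(c)` is injective as soon as the base has a geometric point (the basis clause
  `basis_injective` of [MumfordFogartyKirwan1994, Ch. 7 §2 Def. 7.1] at that point, ★ `eq_zero_of_restrict_section_eq_one`);
* `LevelStructure.natCard_eq_of_mem_iff` — **`#K = #K₀`** for `K = φ(K₀)`;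
* `LevelStructure.natCard_eq_pow_of_mem_iff_heckeKernel` — **`#K = ν^g`** for the Hecke kernel
  `K₀ = {c : (γ̄ · R′) c = 0}` of an integral similitude datum of multiplier `ν` at a principal representative `r′`
  (★ `natCard_heckeKernel_of_eq_pow`: `#K₀ = |det γ| = ν^g`, [ShimuraIATAF1971] §3.2; [Milne2005ShimuraVarieties] §6 Thm. 6.11:
  the Hecke isogeny of a similitude of multiplier `ν` has degree `ν^g`);
* `LevelStructure.natCard_mul_natCard_map_lam_eq_pow_of_mem_iff_heckeKernel` — **`#K · #(λ_* K) = ν^{2g}`** for a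
  polarisation `λ` of type `δ` prime to `ν` (★ `natCard_map_lam_eq_of_mem_iff`: `λ` is injective on the `ν`-torsion `K`),
  the `hcard` binder of ★ `exists_fpqcCover_pullback_poincareQuotRigid_iso` at `K′ := λ_* K`.

This is the `|K| = ν^g` input of the per-point degree count `|ker ψ_s| · |ker ψ^∨_s| = ν^{2g}` (with ★
`natCard_ker_fibreHom_quotientMk : |ker ψ_s| = |K|`) and of the dual-side count `|K| · |K′| = ν^{2g}`.

## References

* [MumfordFogartyKirwan1994] D. Mumford, J. Fogarty, F. Kirwan, *Geometric Invariant Theory* (3rd ed., 1994), Ch. 7 §2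
  Definition 7.1 (p. 129).
* [ShimuraIATAF1971] G. Shimura, *Introduction to the Arithmetic Theory of Automorphic Functions* (1971), §3.2.
* [Milne2005ShimuraVarieties] J. S. Milne, *Introduction to Shimura Varieties* (2005), §6 Thm. 6.11 pp. 74–75.
-/

noncomputable section

universe u

open CategoryTheory CategoryTheory.Limits AlgebraicGeometry MonoidalCategory Matrix NumberField IsDedekindDomain
open scoped MonObj

namespace Literature.AlgebraicGeometry.AbelianSchemes

namespace AbelianSchemeOver

open Literature.AlgebraicGeometry.ModuliOfAbelianVarieties
open Literature.NumberTheory.Adeles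

variable {S : Scheme.{u}} {A : AbelianSchemeOver S} {g n : ℕ}

namespace LevelStructure

variable (φ : A.LevelStructure g n)

/-! ### §1 `φ` is injective on exponent vectors over a base with a geometric point -/

/-- **`c ↦ φ(c)` is injective** when the base has a geometric point `s̄` (`φ(c) = φ(c′) ⇒ φ(c − c′)(s̄) = 1 ⇒ c = c′`, the
basis clause at `s̄`). [cite: MumfordFogartyKirwan1994, Ch. 7 §2 Definition 7.1 (p. 129)] -/
theorem section_injective [IsCommMonObj A.X] [NeZero n] {Ω : Type u} [Field Ω] [IsAlgClosed Ω]
    (s : Spec (.of Ω) ⟶ S) : Function.Injective fun c : Fin g ⊕ Fin g → ZMod n => φ.section_ c := by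
  intro c c' h
  have h1 : φ.section_ (c - c') = 1 := by
    change φ.section_ c = φ.section_ c' at h
    rw [sub_eq_add_neg, φ.section_add, φ.section_neg, h, mul_inv_cancel]
  have h2 : A.restrict s (φ.section_ (c - c')) = 1 := by rw [h1, A.restrict_one]
  exact sub_eq_zero.1 (φ.eq_zero_of_restrict_section_eq_one s h2)

/-! ### §2 `#φ(K₀) = #K₀` -/

/-- **`#K = #K₀`** for the constant subgroup of sections `K = φ(K₀)` (`σ ∈ K ↔ ∃ c ∈ K₀, φ(c) = σ`) over a base with a
geometric point: `c ↦ φ(c)` is a bijection `K₀ → K`. [cite: MumfordFogartyKirwan1994, Ch. 7 §2 Definition 7.1 (p. 129)] -/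
theorem natCard_eq_of_mem_iff [IsCommMonObj A.X] [NeZero n] {K₀ : Set (Fin g ⊕ Fin g → ZMod n)}
    {K : Subgroup A.Sections} (hK : ∀ σ : A.Sections, σ ∈ K ↔ ∃ c ∈ K₀, φ.section_ c = σ)
    {Ω : Type u} [Field Ω] [IsAlgClosed Ω] (s : Spec (.of Ω) ⟶ S) : Nat.card K = Nat.card K₀ := by
  refine (Nat.card_congr (Equiv.ofBijective (fun c : K₀ => (⟨φ.section_ c, (hK _).2 ⟨c, c.2, rfl⟩⟩ : K)) ⟨?_, ?_⟩)).symm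
  · intro c c' h
    exact Subtype.ext (φ.section_injective s (congrArg (fun σ : K => (σ : A.Sections)) h))
  · rintro ⟨σ, hσ⟩
    obtain ⟨c, hc, rfl⟩ := (hK σ).1 hσ
    exact ⟨⟨c, hc⟩, rfl⟩

/-! ### §3 The Hecke kernel: `#K = ν^g` -/

/-- **THE HECKE KERNEL OF SECTIONS HAS ORDER `ν^g`**: for the integral datum `γ γ⋆ = ν·1`, `ᵗγ⋆ E_δ γ⋆ = ν E_δ` of a link of
degree `ν`, a level-`M` structure `φ` (`ν ∣ M`), a principal representative `r′ ∈ K_δ(1)`, and `K = φ(K₀)` with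
`K₀ = {c : (γ̄ · R′) c = 0}` (`R′ = r′ mod M`, spelled as the matrix of residues), `#K = ν^g` — over any base with a
geometric point. [cite: ShimuraIATAF1971, §3.2 («det β = b»)] [cite: Milne2005ShimuraVarieties, §6 Thm. 6.11 pp. 74–75]
[cite: MumfordFogartyKirwan1994, Ch. 7 §2 Definition 7.1 (p. 129)] -/
theorem natCard_eq_pow_of_mem_iff_heckeKernel [IsCommMonObj A.X] {M : ℕ} [NeZero M] {δ : Fin g → ℕ}
    (hδ : IsPolarizationType δ) (hg : 0 < g) {ν : ℕ} (hν : ν ≠ 0)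
    (γm γs : Matrix (Fin g ⊕ Fin g) (Fin g ⊕ Fin g) ℤ) (hγ : γm * γs = (ν : ℤ) • (1 : Matrix _ _ ℤ))
    (hsim : γsᵀ * typeForm δ * γs = (ν : ℤ) • typeForm δ) (hM : ν ∣ M)
    {r' : gspFinAdelic δ} (hr' : r' ∈ principalLevelSubgroup δ 1) (φ : A.LevelStructure g M)
    {K : Subgroup A.Sections}
    (hK : ∀ σ : A.Sections, σ ∈ K ↔ ∃ c ∈ {c : Fin g ⊕ Fin g → ZMod M |
      (γm.map (Int.castRingHom (ZMod M)) *
        Matrix.of (fun i j => integralAdeleResidue M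
          ⟨((r' : GL (Fin g ⊕ Fin g) finAdeleQ) : Matrix (Fin g ⊕ Fin g) (Fin g ⊕ Fin g) finAdeleQ) i j,
            entries_mem_integralAdeles_of_mem_principalLevelSubgroup_one hr' i j⟩)) *ᵥ c = 0}, φ.section_ c = σ)
    {Ω : Type u} [Field Ω] [IsAlgClosed Ω] (s : Spec (.of Ω) ⟶ S) : Nat.card K = ν ^ g := by
  rw [φ.natCard_eq_of_mem_iff hK s]
  exact natCard_heckeKernel_of_eq_pow hδ hg hν γm γs hγ hsim hM hr'

/-! ### §4 The dual-side count `#K · #(λ_* K) = ν^{2g}` -/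

/-- **`#K · #K′ = ν^{2g}` FOR `K′ := λ_* K`**: with `K = φ(K₀)` the Hecke kernel of sections (`#K = ν^g`) killed by `ν` and
`λ` a polarisation of type `δ` with `(∏ δᵢ, ν) = 1` (so `σ ↦ σ ≫ λ` is injective on `K`, ★ `natCard_map_lam_eq_of_mem_iff`),
`#K · #(λ_* K) = ν^g · ν^g = ν^{2g}` — the `hcard` binder of the quotient dual pair's universal property at
`K′ := K.map (σ ↦ σ ≫ λ)`. [cite: ShimuraIATAF1971, §3.2 («det β = b»)] [cite: MumfordAV1970, §7 Thm. 4 (p. 72) and §23 (p. 231)]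
[cite: MumfordFogartyKirwan1994, Ch. 7 §2 Definition 7.1 (p. 129) and App. 7A (pp. 234–235)] -/
theorem natCard_mul_natCard_map_lam_eq_pow_of_mem_iff_heckeKernel [IsCommMonObj A.X] {M : ℕ} [NeZero M]
    {δ : Fin g → ℕ} (hδ : IsPolarizationType δ) (hg : 0 < g) {ν : ℕ} (hν : ν ≠ 0)
    (γm γs : Matrix (Fin g ⊕ Fin g) (Fin g ⊕ Fin g) ℤ) (hγ : γm * γs = (ν : ℤ) • (1 : Matrix _ _ ℤ))
    (hsim : γsᵀ * typeForm δ * γs = (ν : ℤ) • typeForm δ) (hM : ν ∣ M)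
    {r' : gspFinAdelic δ} (hr' : r' ∈ principalLevelSubgroup δ 1) (φ : A.LevelStructure g M)
    {D : A.DualPair} (pol : A.Polarization D) (hT : pol.HasType δ) (hcop : Nat.Coprime (∏ i, δ i) ν)
    {K : Subgroup A.Sections}
    (hK : ∀ σ : A.Sections, σ ∈ K ↔ ∃ c ∈ {c : Fin g ⊕ Fin g → ZMod M |
      (γm.map (Int.castRingHom (ZMod M)) *
        Matrix.of (fun i j => integralAdeleResidue M
          ⟨((r' : GL (Fin g ⊕ Fin g) finAdeleQ) : Matrix (Fin g ⊕ Fin g) (Fin g ⊕ Fin g) finAdeleQ) i j,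
            entries_mem_integralAdeles_of_mem_principalLevelSubgroup_one hr' i j⟩)) *ᵥ c = 0}, φ.section_ c = σ)
    (hKν : ∀ σ : K, (σ : A.Sections) ^ ν = 1)
    {Ω : Type u} [Field Ω] [IsAlgClosed Ω] (s : Spec (.of Ω) ⟶ S) :
    haveI := pol.isMonHom
    Nat.card K * Nat.card (K.map (IsMonHom.monoidHom pol.lam (𝟙_ (Over S)))) = ν ^ (2 * g) := by
  rw [A.natCard_map_lam_eq_of_mem_iff pol φ hT hcop hK hKν s,
    φ.natCard_eq_pow_of_mem_iff_heckeKernel hδ hg hν γm γs hγ hsim hM hr' hK s, ← pow_add, two_mul]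

end LevelStructure

end AbelianSchemeOver

end Literature.AlgebraicGeometry.AbelianSchemes

end
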